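import Summits.QuantumFields.BalabanUV.T4Continuum.Support.RegionElectricSplitting

/-!
# T⁴ programme, spine node NE2 (U1a), sub-row Δ1 «NE2⁰-Dirichlet» — ON PRODUCT REGIONS THE DIRECTIONAL PIECES OF THE ELECTRIC OPERATOR
# COMMUTE: `Idiff μ` commutes with `Idiff μ′`, with `(Idiff μ′)ᴴ` and with `diag(n²·tcnt μ′)` (`μ ≠ μ′`, every `IsCoordBox`, every level)

NE2 formalisation swarm `b2b-balaban-t4-ne2-formalise-*`, LEAF PROVER 02 (gen 8), supplier item «Δ1-LOC-HESS» (owner R34 (b)'s (R-hess-interior),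
re-targeted per owner g15's O15-a (W-a) to the LOCAL operator `Δ_loc = curlRᴴcurlR + gradR·gradRᴴ + a n^d·avgRᴴavgR` — «(R) budgets for
G̃, whose H² is corner-free SCALAR business»), file 2 of 3, on file 1 `Support/RegionElectricSplitting` (the directional pieces
`W_μ = (Idiff μ)ᴴ·Idiff μ + diag(n²·tcnt μ)`, `electric_splitting : curlRᴴcurlR + gradR·gradRᴴ = Σ_μ W_μ` under H1); file 3
`Support/RegionElectricHessian` draws the corner-free H² from the commutations proved here.  The scalar all-Dirichlet model is gan24-p2-g22's
`DirichletBoxRegularity` (corner-free zero-extension argument); the own direction of each component being NEUMANN here, the zero-extension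
argument does not apply verbatim — commutation of the directional pieces on a PRODUCT region replaces it:

 * §1 `Idiff_conjTranspose_apply` / `Idiff_conjTranspose_mulVec`: the adjoint `((Idiff μ)ᴴB)(c) = n·([c − e_μ ∈ V]B(c − e_μ) − [c + e_μ ∈ V]B(c))`.
 * §2 PRODUCT REGIONS (`IsCoordBox`, coordinate sets `S₀`): star membership of component `ν` is COORDINATEWISE (`starReg_iff_Qc`); hence
   from a star bond two unit translations in DIFFERENT coordinates land on a star bond iff each does (**`starReg_add_add_iff`**, all sign
   combinations via `OnlyMoves`), and the per-direction / transverse charges are constant along interior transverse steps (`cnt1_add_eq`,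
   `tcnt_add_eq`).
 * §3 the three operators read on the ambient bond lattice through the zero extension (`Gop`, `Gtop`, `Dop`; `Dg μ = diag(n²·tcnt μ)`,
   `Wdir_eq : W_μ = (Idiff μ)ᴴ·Idiff μ + Dg μ`; transfer lemmas `ext_Idiff_mulVec`, `ext_Idiff_conjTranspose_mulVec`, `ext_Dg_mulVec`,
   `ext_injective`), their COMMUTATION for `μ ≠ μ′` on product regions (`Gop_comm`, `Gop_Gtop_comm`, `Gop_Dop_comm` — finite case analysis on
   the coordinatewise membership), pulled back to the star bonds: **`Idiff_Idiff_comm`**, **`Idiff_IdiffH_comm`**, **`Idiff_Dg_comm`**.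

HONEST FRAMING (T4-DAG p. 1).  Lattice calculus at MODEL level (`U = 1`, ONE region = a product of coordinate sets, finite torus); statements
OURS ([folklore]); nothing printed is a hypothesis; general unions of blocks NOT covered; W3 on boxes OPEN; Δ1 NOT closed; NE2 (U1a) NOT
proved; spine PROVED 0/9 unchanged; NOT [B9] (3.16)/(3.23)–(3.27) as printed; NOT infinite volume, NOT a mass gap, NOT the Clay problem.
HONEST DEPENDENCY: continuum YM on T⁴ ⇐ BetaPertH ∧ nine spine estimates (0/9 proved); BetaPertH ⇐ (D1) ∧ (D4) ∧ CAP+tail; G-an2-4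
gates asym, D1 and NE2/3/4.  No `sorry`.
-/

noncomputable section

open scoped BigOperators ComplexConjugate Matrix Matrix.Norms.L2Operator
open Finset

namespace Summit.QuantumFields.BalabanUV.T4Continuum.RegionElectricCommutation

open Literature.MathematicalPhysics.QuantumFieldTheory.Balaban1983to89.B5Prop11Plancherel (Tor fine unitVec)
open Literature.MathematicalPhysics.QuantumFieldTheory.Balaban1983to89.B5Prop11Lower (nsq nsq_nonneg star_dotProduct_self)
open Literature.MathematicalPhysics.QuantumFieldTheory.Balaban1983to89.B5Action121 (star_mulVec_dotProduct)
open Literature.MathematicalPhysics.QuantumFieldTheory.Balaban1983to89.B5Blocks16 (blockOf)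
open Summit.QuantumFields.BalabanUV.T4Continuum
open Summit.QuantumFields.BalabanUV.T4Continuum.SubtypeCompression (ext_apply_of ext_apply_of_not)
open Summit.QuantumFields.BalabanUV.T4Continuum.RegionGaugeFixedVector (starReg curlR gradR avgR)
open Summit.QuantumFields.BalabanUV.T4Continuum.DirichletStarRenormTower (igrad)
open Summit.QuantumFields.BalabanUV.T4Continuum.RegionStarBoundaryCharges (blockOf_add_unitVec_apply_of_ne blockOf_sub_unitVec_apply_of_ne)
open Summit.QuantumFields.BalabanUV.T4Continuum.RegionElectricSplitting (Idiff Idiff_mulVec cnt1 tcnt tcnt_nonneg Wdir form_diagonal_ofReal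
  electric_splitting_box)
open Summit.QuantumFields.BalabanUV.Beta.GAN24.DirichletBoxTrace (blockReg)
open Summit.QuantumFields.BalabanUV.Beta.GAN24.DirichletBoxTwoLevel (IsCoordBox)

variable {d : ℕ}

/-! ## §1 Sums over the star bonds picking one underlying bond; the adjoint of `Idiff` -/

/-- a sum over a subtype of an indicator of ONE underlying value. [folklore] -/
theorem sum_subtype_ite_eq {α : Type*} [Fintype α] [DecidableEq α] (p : α → Prop) [DecidablePred p] (t : α)
    (f : {a // p a} → ℂ) :
    ∑ y : {a // p a}, (if y.1 = t then f y else 0) = if h : p t then f ⟨t, h⟩ else 0 := by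
  by_cases h : p t
  · rw [dif_pos h, Finset.sum_eq_single ⟨t, h⟩]
    · rw [if_pos rfl]
    · intro y _ hy
      rw [if_neg]
      intro e
      exact hy (Subtype.ext e)
    · intro hh; exact absurd (mem_univ _) hh
  · rw [dif_neg h]
    exact Finset.sum_eq_zero fun y _ => by
      rw [if_neg]
      intro e
      exact h (e ▸ y.2)

section Region

variable (n : ℕ) [NeZero n] (M : Fin d → ℕ) [hM : ∀ μ, NeZero (M μ)] (S : Tor M → Prop) [DecidablePred S]

/-- pointwise unfolding of `igrad`. [folklore] -/
theorem igrad_apply (μ : Fin d) (w : {b // starReg n M S b} → ℂ) (y : {b // starReg n M S b}) :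
    igrad M S n μ w y = if h : starReg n M S (y.1.1 + unitVec (fine n M) μ, y.1.2)
      then (n : ℂ) * (w ⟨(y.1.1 + unitVec (fine n M) μ, y.1.2), h⟩ - w y) else 0 := rfl

/-- the entries of the ADJOINT of `Idiff μ`: `(Idiff μ)ᴴ c y = n·([y = c − e_μ] − [c + e_μ ∈ V][y = c])`. [folklore] -/
theorem Idiff_conjTranspose_apply (μ : Fin d) (c y : {b // starReg n M S b}) :
    (Idiff n M S μ)ᴴ c y = (n : ℂ) * ((if y.1 = (c.1.1 - unitVec (fine n M) μ, c.1.2) then 1 else 0)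
      - (if starReg n M S (c.1.1 + unitVec (fine n M) μ, c.1.2) ∧ y = c then 1 else 0)) := by
  rw [Matrix.conjTranspose_apply]
  unfold Idiff
  by_cases h : starReg n M S (y.1.1 + unitVec (fine n M) μ, y.1.2)
  · rw [dif_pos h]
    have e1 : (c = ⟨(y.1.1 + unitVec (fine n M) μ, y.1.2), h⟩) ↔ (y.1 = (c.1.1 - unitVec (fine n M) μ, c.1.2)) := by
      constructor
      · intro hc; rw [hc]; simp
      · intro hy
        apply Subtype.ext
        change c.1 = (y.1.1 + unitVec (fine n M) μ, y.1.2)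
        rw [hy]; simp
    have e2 : (c = y) ↔ (starReg n M S (c.1.1 + unitVec (fine n M) μ, c.1.2) ∧ y = c) := by
      constructor
      · intro hc; subst hc; exact ⟨h, rfl⟩
      · intro hc; exact hc.2.symm
    simp only [e1, e2, star_mul', star_sub, Complex.star_def, Complex.conj_natCast, apply_ite (starRingEnd ℂ), map_one, map_zero]
  · rw [dif_neg h, star_zero]
    have e1 : ¬ (y.1 = (c.1.1 - unitVec (fine n M) μ, c.1.2)) := by
      intro hy
      apply h
      have : (y.1.1 + unitVec (fine n M) μ, y.1.2) = c.1 := by rw [hy]; simp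
      rw [this]; exact c.2
    have e2 : ¬ (starReg n M S (c.1.1 + unitVec (fine n M) μ, c.1.2) ∧ y = c) := by
      rintro ⟨hc, hyc⟩; subst hyc; exact h hc
    rw [if_neg e1, if_neg e2, sub_zero, mul_zero]

/-- the ADJOINT of `Idiff μ` acts as `((Idiff μ)ᴴ B)(c) = n·([c − e_μ ∈ V]·B(c − e_μ) − [c + e_μ ∈ V]·B(c))`. [folklore] -/
theorem Idiff_conjTranspose_mulVec (μ : Fin d) (B : {b // starReg n M S b} → ℂ) (c : {b // starReg n M S b}) :
    ((Idiff n M S μ)ᴴ *ᵥ B) c = (n : ℂ) * ((if h : starReg n M S (c.1.1 - unitVec (fine n M) μ, c.1.2)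
        then B ⟨(c.1.1 - unitVec (fine n M) μ, c.1.2), h⟩ else 0)
      - (if starReg n M S (c.1.1 + unitVec (fine n M) μ, c.1.2) then B c else 0)) := by
  simp only [Matrix.mulVec, dotProduct, Idiff_conjTranspose_apply, mul_sub, sub_mul, sum_sub_distrib, mul_assoc, ← mul_sum, ite_mul,
    one_mul, zero_mul]
  congr 2
  · exact sum_subtype_ite_eq (starReg n M S) _ B
  · by_cases hc : starReg n M S (c.1.1 + unitVec (fine n M) μ, c.1.2)
    · simp only [hc, true_and, if_true]
      rw [Finset.sum_ite_eq' univ c, if_pos (mem_univ _)]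
    · simp only [hc, false_and, if_false, sum_const_zero]

/-! ## §2 Product regions: star membership is coordinatewise, component by component -/

section Coord

variable (S₀ : (μ : Fin d) → Finset (ZMod (M μ)))

/-- [shape] the per-coordinate membership predicate of the star bonds of component `ν` on a product region with coordinate sets
`S₀`: block coordinate `λ ≠ ν` of the site lies in `S₀ λ`; block coordinate `ν` of the site, or of the site one step up, lies in `S₀ ν`.
[folklore] -/
def Qc (ν lam : Fin d) (x : Tor (fine n M)) : Prop :=
  if lam = ν then (blockOf n M x ν ∈ S₀ ν ∨ blockOf n M (x + unitVec (fine n M) ν) ν ∈ S₀ ν) else blockOf n M x lam ∈ S₀ lam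

variable {S₀} (hS₀ : ∀ b, S b ↔ ∀ μ, b μ ∈ S₀ μ)
include hS₀

omit [DecidablePred S] in
/-- **STAR MEMBERSHIP IS COORDINATEWISE**: `(x, ν) ∈ V ↔ ∀ λ, Qc ν λ x`. [folklore] -/
theorem starReg_iff_Qc (x : Tor (fine n M)) (ν : Fin d) : starReg n M S (x, ν) ↔ ∀ lam, Qc n M S₀ ν lam x := by
  unfold starReg blockReg Qc
  simp only
  rw [hS₀, hS₀]
  constructor
  · rintro (h1 | h2) lam
    · by_cases hl : lam = ν
      · rw [if_pos hl]; subst hl; exact Or.inl (h1 lam)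
      · rw [if_neg hl]; exact h1 lam
    · by_cases hl : lam = ν
      · rw [if_pos hl]; subst hl; exact Or.inr (h2 lam)
      · rw [if_neg hl, ← blockOf_add_unitVec_apply_of_ne n M x hl]; exact h2 lam
  · intro h
    have hν := h ν
    rw [if_pos rfl] at hν
    rcases hν with h1 | h2
    · refine Or.inl fun lam => ?_
      by_cases hl : lam = ν
      · subst hl; exact h1
      · have := h lam; rw [if_neg hl] at this; exact this
    · refine Or.inr fun lam => ?_
      by_cases hl : lam = ν
      · subst hl; exact h2
      · have := h lam; rw [if_neg hl] at this; rw [blockOf_add_unitVec_apply_of_ne n M x hl]; exact this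

omit hS₀

/-- [shape] a lattice vector that moves the block coordinates only in direction `μ` (e.g. `±e_μ`). [folklore] -/
def OnlyMoves (v : Tor (fine n M)) (μ : Fin d) : Prop := ∀ (y : Tor (fine n M)) (lam : Fin d), lam ≠ μ → blockOf n M (y + v) lam = blockOf n M y lam

omit [DecidablePred S] in
/-- `e_μ` moves only coordinate `μ`. [folklore] -/
theorem onlyMoves_unitVec (μ : Fin d) : OnlyMoves n M (unitVec (fine n M) μ) μ := fun y _ h => blockOf_add_unitVec_apply_of_ne n M y h

omit [DecidablePred S] in
/-- `−e_μ` moves only coordinate `μ`. [folklore] -/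
theorem onlyMoves_neg_unitVec (μ : Fin d) : OnlyMoves n M (-unitVec (fine n M) μ) μ := fun y _ h => by
  rw [← sub_eq_add_neg]; exact blockOf_sub_unitVec_apply_of_ne n M y h

omit [DecidablePred S] in
/-- translating by a vector that moves only coordinate `μ` does not change `Qc ν λ` for `λ ≠ μ`. [folklore] -/
theorem Qc_add_iff {v : Tor (fine n M)} {μ : Fin d} (hv : OnlyMoves n M v μ) {lam : Fin d} (hl : lam ≠ μ) (ν : Fin d)
    (x : Tor (fine n M)) : Qc n M S₀ ν lam (x + v) ↔ Qc n M S₀ ν lam x := by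
  unfold Qc
  by_cases hln : lam = ν
  · subst hln
    rw [if_pos rfl, if_pos rfl, hv x lam hl, add_right_comm, hv _ lam hl]
  · rw [if_neg hln, if_neg hln, hv x lam hl]

include hS₀

omit [DecidablePred S] in
/-- **TWO TRANSLATIONS IN DIFFERENT COORDINATES**: from a star bond, `x + v + v′` is a star bond iff both `x + v` and `x + v′` are
(`v` moves only `μ`, `v′` only `μ′ ≠ μ`). [folklore] -/
theorem starReg_add_add_iff {μ μ' : Fin d} (hμ : μ ≠ μ') {v v' : Tor (fine n M)} (hv : OnlyMoves n M v μ) (hv' : OnlyMoves n M v' μ')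
    {x : Tor (fine n M)} {ν : Fin d} (hx : starReg n M S (x, ν)) :
    starReg n M S (x + v + v', ν) ↔ starReg n M S (x + v, ν) ∧ starReg n M S (x + v', ν) := by
  rw [starReg_iff_Qc n M S hS₀, starReg_iff_Qc n M S hS₀, starReg_iff_Qc n M S hS₀] at *
  constructor
  · intro h
    refine ⟨fun lam => ?_, fun lam => ?_⟩
    · by_cases hl : lam = μ
      · have hl' : lam ≠ μ' := by rw [hl]; exact hμ
        exact (Qc_add_iff n M hv' hl' ν (x + v)).mp (h lam)
      · exact (Qc_add_iff n M hv hl ν x).mpr (hx lam)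
    · by_cases hl : lam = μ'
      · have hl' : lam ≠ μ := by rw [hl]; exact hμ.symm
        have := h lam
        rw [add_right_comm] at this
        exact (Qc_add_iff n M hv hl' ν (x + v')).mp this
      · exact (Qc_add_iff n M hv' hl ν x).mpr (hx lam)
  · rintro ⟨h1, h2⟩ lam
    by_cases hl : lam = μ
    · have hl' : lam ≠ μ' := by rw [hl]; exact hμ
      exact (Qc_add_iff n M hv' hl' ν (x + v)).mpr (h1 lam)
    · rw [add_right_comm]
      exact (Qc_add_iff n M hv hl ν (x + v')).mpr (h2 lam)

omit [DecidablePred S] in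
/-- hence one translation in a coordinate `μ ≠ μ′` does not change the `μ′`-translates' star membership. [folklore] -/
theorem starReg_add_shift_iff {μ μ' : Fin d} (hμ : μ ≠ μ') {v v' : Tor (fine n M)} (hv : OnlyMoves n M v μ) (hv' : OnlyMoves n M v' μ')
    {x : Tor (fine n M)} {ν : Fin d} (hx : starReg n M S (x, ν)) (hxv : starReg n M S (x + v, ν)) :
    starReg n M S (x + v + v', ν) ↔ starReg n M S (x + v', ν) := by
  rw [starReg_add_add_iff n M S hS₀ hμ hv hv' hx]
  exact ⟨fun h => h.2, fun h => ⟨hxv, h⟩⟩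

/-- **THE CHARGES ARE CONSTANT ALONG INTERIOR TRANSVERSE STEPS**: `cnt1 μ′ (x + v, ν) = cnt1 μ′ (x, ν)` for `v` moving only `μ ≠ μ′`,
both bonds star. [folklore] -/
theorem cnt1_add_eq {μ μ' : Fin d} (hμ : μ ≠ μ') {v : Tor (fine n M)} (hv : OnlyMoves n M v μ) {x : Tor (fine n M)} {ν : Fin d}
    (hx : starReg n M S (x, ν)) (hxv : starReg n M S (x + v, ν)) :
    cnt1 n M S μ' (x + v, ν) = cnt1 n M S μ' (x, ν) := by
  unfold cnt1
  have e1 : starReg n M S (x + v + unitVec (fine n M) μ', ν) ↔ starReg n M S (x + unitVec (fine n M) μ', ν) :=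
    starReg_add_shift_iff n M S hS₀ hμ hv (onlyMoves_unitVec n M μ') hx hxv
  have e2 : starReg n M S (x + v - unitVec (fine n M) μ', ν) ↔ starReg n M S (x - unitVec (fine n M) μ', ν) := by
    rw [sub_eq_add_neg, sub_eq_add_neg]
    exact starReg_add_shift_iff n M S hS₀ hμ hv (onlyMoves_neg_unitVec n M μ') hx hxv
  simp only [e1, e2]

/-- … hence so are the transverse charges. [folklore] -/
theorem tcnt_add_eq {μ μ' : Fin d} (hμ : μ ≠ μ') {v : Tor (fine n M)} (hv : OnlyMoves n M v μ) {x : Tor (fine n M)} {ν : Fin d}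
    (hx : starReg n M S (x, ν)) (hxv : starReg n M S (x + v, ν)) :
    tcnt n M S μ' (x + v, ν) = tcnt n M S μ' (x, ν) := by
  unfold tcnt
  simp only [cnt1_add_eq n M S hS₀ hμ hv hx hxv]


/-! ## §3 The three operators read on the ambient bond lattice (no subtypes), and their commutation on product regions -/

omit hS₀

/-- `igrad_μ` on the ambient bond lattice: `n·(f(z + e_μ) − f(z))` on star bonds whose forward `μ`-translate is a star bond, else `0`.
[folklore] -/
def Gop (μ : Fin d) (f : Tor (fine n M) × Fin d → ℂ) : Tor (fine n M) × Fin d → ℂ := fun z =>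
  if starReg n M S z ∧ starReg n M S (z.1 + unitVec (fine n M) μ, z.2) then (n : ℂ) * (f (z.1 + unitVec (fine n M) μ, z.2) - f z) else 0

/-- the adjoint of `igrad_μ` on the ambient bond lattice. [folklore] -/
def Gtop (μ : Fin d) (g : Tor (fine n M) × Fin d → ℂ) : Tor (fine n M) × Fin d → ℂ := fun z =>
  (n : ℂ) * ((if starReg n M S z ∧ starReg n M S (z.1 - unitVec (fine n M) μ, z.2) then g (z.1 - unitVec (fine n M) μ, z.2) else 0)
    - (if starReg n M S z ∧ starReg n M S (z.1 + unitVec (fine n M) μ, z.2) then g z else 0))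

/-- the transverse-charge multiplier `n²·tcnt μ` on the ambient bond lattice. [folklore] -/
def Dop (μ : Fin d) (f : Tor (fine n M) × Fin d → ℂ) : Tor (fine n M) × Fin d → ℂ := fun z =>
  (((n : ℝ) ^ 2 * tcnt n M S μ z : ℝ) : ℂ) * f z

/-- the diagonal of the transverse charges on the star bonds: `Wdir μ = (Idiff μ)ᴴ·Idiff μ + Dg μ`. [folklore] -/
def Dg (μ : Fin d) : Matrix {b // starReg n M S b} {b // starReg n M S b} ℂ :=
  Matrix.diagonal (fun b => (((n : ℝ) ^ 2 * tcnt n M S μ b.1 : ℝ) : ℂ))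

/-- `Wdir μ = (Idiff μ)ᴴ·Idiff μ + Dg μ` (definitional). [folklore] -/
theorem Wdir_eq (μ : Fin d) : Wdir n M S μ = (Idiff n M S μ)ᴴ * Idiff n M S μ + Dg n M S μ := rfl

/-- the zero extension is injective. [folklore] -/
theorem ext_injective {A B : {b // starReg n M S b} → ℂ} (h : SubtypeCompression.ext (starReg n M S) A = SubtypeCompression.ext (starReg n M S) B) : A = B := by
  funext y
  rw [← ext_apply_of (starReg n M S) A y, ← ext_apply_of (starReg n M S) B y, h]

/-- transfer: `ι(Idiff μ w) = Gop μ (ι w)`. [folklore] -/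
theorem ext_Idiff_mulVec (μ : Fin d) (w : {b // starReg n M S b} → ℂ) :
    SubtypeCompression.ext (starReg n M S) (Idiff n M S μ *ᵥ w) = Gop n M S μ (SubtypeCompression.ext (starReg n M S) w) := by
  rw [Idiff_mulVec]
  funext z
  unfold Gop SubtypeCompression.ext
  by_cases hz : starReg n M S z
  · rw [dif_pos hz, igrad_apply]
    by_cases h1 : starReg n M S (z.1 + unitVec (fine n M) μ, z.2)
    · rw [dif_pos h1, if_pos ⟨hz, h1⟩, dif_pos h1, dif_pos hz]
    · rw [dif_neg h1, if_neg (fun h => h1 h.2)]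
  · rw [dif_neg hz, if_neg (fun h => hz h.1)]

/-- transfer: `ι((Idiff μ)ᴴ B) = Gtop μ (ι B)`. [folklore] -/
theorem ext_Idiff_conjTranspose_mulVec (μ : Fin d) (B : {b // starReg n M S b} → ℂ) :
    SubtypeCompression.ext (starReg n M S) ((Idiff n M S μ)ᴴ *ᵥ B) = Gtop n M S μ (SubtypeCompression.ext (starReg n M S) B) := by
  funext z
  unfold Gtop SubtypeCompression.ext
  by_cases hz : starReg n M S z
  · rw [dif_pos hz, Idiff_conjTranspose_mulVec, dif_pos hz]
    congr 2
    · by_cases h1 : starReg n M S (z.1 - unitVec (fine n M) μ, z.2)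
      · rw [dif_pos h1, if_pos ⟨hz, h1⟩]
      · rw [dif_neg h1, if_neg (fun h => h1 h.2)]
    · by_cases h1 : starReg n M S (z.1 + unitVec (fine n M) μ, z.2)
      · rw [if_pos h1, if_pos ⟨hz, h1⟩]
      · rw [if_neg h1, if_neg (fun h => h1 h.2)]
  · rw [dif_neg hz, if_neg (fun h => hz h.1), if_neg (fun h => hz h.1), sub_zero, mul_zero]

/-- transfer: `ι(Dg μ A) = Dop μ (ι A)`. [folklore] -/
theorem ext_Dg_mulVec (μ : Fin d) (A : {b // starReg n M S b} → ℂ) :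
    SubtypeCompression.ext (starReg n M S) (Dg n M S μ *ᵥ A) = Dop n M S μ (SubtypeCompression.ext (starReg n M S) A) := by
  funext z
  unfold Dop Dg SubtypeCompression.ext
  by_cases hz : starReg n M S z
  · rw [dif_pos hz, dif_pos hz, Matrix.mulVec_diagonal]
  · rw [dif_neg hz, dif_neg hz, mul_zero]

include hS₀

/-- **`Gop μ` and `Gop μ′` COMMUTE on a product region** (`μ ≠ μ′`). [folklore] -/
theorem Gop_comm {μ μ' : Fin d} (hμ : μ ≠ μ') (f : Tor (fine n M) × Fin d → ℂ) :
    Gop n M S μ (Gop n M S μ' f) = Gop n M S μ' (Gop n M S μ f) := by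
  funext ⟨x, ν⟩
  unfold Gop
  simp only
  by_cases hz : starReg n M S (x, ν)
  · have key := starReg_add_add_iff n M S hS₀ hμ (onlyMoves_unitVec n M μ) (onlyMoves_unitVec n M μ') hz
    have exx : x + unitVec (fine n M) μ' + unitVec (fine n M) μ = x + unitVec (fine n M) μ + unitVec (fine n M) μ' := add_right_comm _ _ _
    have keyE := propext key
    by_cases ha : starReg n M S (x + unitVec (fine n M) μ, ν) <;> by_cases hb : starReg n M S (x + unitVec (fine n M) μ', ν) <;>
      simp only [hz, ha, hb, keyE, exx, and_self, and_true, and_false, if_true, if_false, sub_zero, mul_zero]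
    ring
  · simp only [hz, false_and, if_false]

/-- **`Gop μ` and the adjoint `Gtop μ′` COMMUTE on a product region** (`μ ≠ μ′`). [folklore] -/
theorem Gop_Gtop_comm {μ μ' : Fin d} (hμ : μ ≠ μ') (g : Tor (fine n M) × Fin d → ℂ) :
    Gop n M S μ (Gtop n M S μ' g) = Gtop n M S μ' (Gop n M S μ g) := by
  funext ⟨x, ν⟩
  unfold Gop Gtop
  simp only
  by_cases hz : starReg n M S (x, ν)
  · have keyp := starReg_add_add_iff n M S hS₀ hμ (onlyMoves_unitVec n M μ) (onlyMoves_unitVec n M μ') hz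
    have keym' := starReg_add_add_iff n M S hS₀ hμ (onlyMoves_unitVec n M μ) (onlyMoves_neg_unitVec n M μ') hz
    have keym : starReg n M S (x + unitVec (fine n M) μ - unitVec (fine n M) μ', ν)
        ↔ starReg n M S (x + unitVec (fine n M) μ, ν) ∧ starReg n M S (x - unitVec (fine n M) μ', ν) := by
      rw [sub_eq_add_neg, sub_eq_add_neg]; exact keym'
    have exx : x - unitVec (fine n M) μ' + unitVec (fine n M) μ = x + unitVec (fine n M) μ - unitVec (fine n M) μ' :=
      sub_add_eq_add_sub _ _ _
    have keypE := propext keyp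
    have keymE := propext keym
    by_cases ha : starReg n M S (x + unitVec (fine n M) μ, ν) <;> by_cases hb : starReg n M S (x - unitVec (fine n M) μ', ν) <;>
      by_cases hc : starReg n M S (x + unitVec (fine n M) μ', ν) <;>
        simp only [hz, ha, hb, hc, keypE, keymE, exx, and_self, and_true, and_false, if_true, if_false, sub_zero, mul_zero] <;> ring
  · simp only [hz, false_and, if_false, sub_zero, mul_zero]

/-- **`Gop μ` and the multiplier `Dop μ′` COMMUTE on a product region** (`μ ≠ μ′`; the transverse charge is constant along interior
`μ`-steps). [folklore] -/
theorem Gop_Dop_comm {μ μ' : Fin d} (hμ : μ ≠ μ') (f : Tor (fine n M) × Fin d → ℂ) :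
    Gop n M S μ (Dop n M S μ' f) = Dop n M S μ' (Gop n M S μ f) := by
  funext ⟨x, ν⟩
  unfold Gop Dop
  simp only
  by_cases hz : starReg n M S (x, ν)
  · by_cases ha : starReg n M S (x + unitVec (fine n M) μ, ν)
    · have ht : tcnt n M S μ' (x + unitVec (fine n M) μ, ν) = tcnt n M S μ' (x, ν) :=
        tcnt_add_eq n M S hS₀ hμ (onlyMoves_unitVec n M μ) hz ha
      simp only [hz, ha, and_self, if_true, ht]
      ring
    · simp only [hz, ha, and_false, if_false, mul_zero]
  · simp only [hz, false_and, if_false, mul_zero]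

/-- on the star bonds: `Idiff μ·Idiff μ′ = Idiff μ′·Idiff μ` (as actions). [folklore] -/
theorem Idiff_Idiff_comm {μ μ' : Fin d} (hμ : μ ≠ μ') (A : {b // starReg n M S b} → ℂ) :
    Idiff n M S μ *ᵥ (Idiff n M S μ' *ᵥ A) = Idiff n M S μ' *ᵥ (Idiff n M S μ *ᵥ A) :=
  ext_injective n M S (by rw [ext_Idiff_mulVec, ext_Idiff_mulVec, ext_Idiff_mulVec, ext_Idiff_mulVec, Gop_comm n M S hS₀ hμ])

/-- on the star bonds: `Idiff μ·(Idiff μ′)ᴴ = (Idiff μ′)ᴴ·Idiff μ` (as actions). [folklore] -/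
theorem Idiff_IdiffH_comm {μ μ' : Fin d} (hμ : μ ≠ μ') (B : {b // starReg n M S b} → ℂ) :
    Idiff n M S μ *ᵥ ((Idiff n M S μ')ᴴ *ᵥ B) = (Idiff n M S μ')ᴴ *ᵥ (Idiff n M S μ *ᵥ B) :=
  ext_injective n M S (by
    rw [ext_Idiff_mulVec, ext_Idiff_conjTranspose_mulVec, ext_Idiff_conjTranspose_mulVec, ext_Idiff_mulVec, Gop_Gtop_comm n M S hS₀ hμ])

/-- on the star bonds: `Idiff μ·Dg μ′ = Dg μ′·Idiff μ` (as actions). [folklore] -/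
theorem Idiff_Dg_comm {μ μ' : Fin d} (hμ : μ ≠ μ') (A : {b // starReg n M S b} → ℂ) :
    Idiff n M S μ *ᵥ (Dg n M S μ' *ᵥ A) = Dg n M S μ' *ᵥ (Idiff n M S μ *ᵥ A) :=
  ext_injective n M S (by rw [ext_Idiff_mulVec, ext_Dg_mulVec, ext_Dg_mulVec, ext_Idiff_mulVec, Gop_Dop_comm n M S hS₀ hμ])

end Coord

end Region

end Summit.QuantumFields.BalabanUV.T4Continuum.RegionElectricCommutation

end
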